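import Literature.AlgebraicGeometry.Morphisms.AffineOfNilpotentThickening
import HarnessLib

/-!
# Opens, affine opens and principal affine covers lift along a nilpotent thickening

Topic `Literature/AlgebraicGeometry/Morphisms`; THEOREMS only (no definition, no named fact, no instance). Sequel of
★ `Morphisms/AffineOfNilpotentThickening` (Stacks 06AD, finite order: an open of a nilpotent thickening with affine
reduction is affine). For a closed immersion `i : X₀ ⟶ X` with NILPOTENT kernel ideal sheaf (a finite-order thickening,
Stacks 04EX (3): «a finite order thickening … `𝓘` … is nilpotent»; the underlying topological spaces are equal):
* `surjective_of_isNilpotent_ker`, `preimage_injective_of_isNilpotent_ker` — `i` is a homeomorphism onto `X`; opens of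
  `X` are determined by their preimages;
* `exists_preimage_eq` — every open `U₀ ⊆ X₀` is `i⁻¹U` for a (unique) open `U ⊆ X`, affine if `U₀` is (06AD);
* **`exists_principal_affine_cover_lift`** — a PRINCIPAL AFFINE cover of `X₀` (`U₀ j` affine, `U₀ j ∩ U₀ l = D(b_{jl})`,
  `b_{jl} ∈ Γ(U₀ j)`) is the preimage of a principal affine cover of `X` (`U j` affine with `i⁻¹U j = U₀ j`,
  `U j ∩ U l = D(b'_{jl})`): lift `b_{jl}` along the surjection `Γ(X, U j) ↠ Γ(X₀, U₀ j)` and compare preimages — as in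
  the proof of Hartshorne's Thm. 10.2 (a) («`U'_i ≅ U_i ×_k Spec A'` … the open covering `𝒰'` of `X'`»).
Cell `hodgecm-mathlib`, F-11 road A (crux `HDel`): the road (β) input «principal affine cover of the closed fibre ↦
principal affine cover upstairs» of the F3c dictionary. HC_CM is proved only modulo the 7 printed citations until rung 0
closes — nothing here bears on a summit statement.

## References
* [StacksProject] The Stacks Project, Tag 06AD (Lemma 37.2.3), Tag 04EX (Definition 37.2.1: thickenings; finite order thickenings).
* [Hartshorne2010] R. Hartshorne, *Deformation Theory*, GTM 257 (2010), Thm. 10.2 (a), proof (p. 81).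
* [GortzWedhorn2020] U. Görtz, T. Wedhorn, *Algebraic Geometry I*, 2nd ed. (2020), Prop. 2.12 / Cor. 2.11
  (`V(𝔞)` with `𝔞` nil is everything).
-/

noncomputable section

open CategoryTheory CategoryTheory.Limits AlgebraicGeometry TopologicalSpace Opposite

universe u

namespace Literature.AlgebraicGeometry.Morphisms

variable {X₀ X : Scheme.{u}} (i : X₀ ⟶ X) [IsClosedImmersion i]

/-- **A nilpotent thickening is onto** (`Supp 𝓘 = Supp 𝓘ⁿ⁺¹ = Supp 0 = X`, and the range of a closed immersion is the
support of its kernel). [cite: StacksProject, Tag 04EX] [cite: GortzWedhorn2020, Cor. 2.11 and Prop. 2.12] -/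
theorem surjective_of_isNilpotent_ker (hnil : IsNilpotent i.ker) : Function.Surjective i := by
  obtain ⟨n, hn⟩ := hnil
  have hsupp : i.ker.support = ⊤ := by
    rw [← Scheme.IdealSheafData.support_pow_succ i.ker n, pow_succ, hn, zero_mul,
      Scheme.IdealSheafData.zero_eq_bot, Scheme.IdealSheafData.support_bot]
  have h := Scheme.Hom.support_ker i
  rw [hsupp, i.isClosedEmbedding.isClosed_range.closure_eq] at h
  exact Set.range_eq_univ.mp (by simpa using h.symm)

/-- Opens of a nilpotent thickening are determined by their preimages. [cite: StacksProject, Tag 04EX] -/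
theorem preimage_injective_of_isNilpotent_ker (hnil : IsNilpotent i.ker) {U V : X.Opens} (h : i ⁻¹ᵁ U = i ⁻¹ᵁ V) :
    U = V := by
  have hs := surjective_of_isNilpotent_ker i hnil
  ext x
  obtain ⟨y, rfl⟩ := hs x
  change y ∈ i ⁻¹ᵁ U ↔ y ∈ i ⁻¹ᵁ V
  rw [h]

/-- **Opens lift along a nilpotent thickening** (`i` is a homeomorphism): every open `U₀ ⊆ X₀` is `i⁻¹U` for an open
`U ⊆ X`, which is affine when `U₀` is (★ `isAffineOpen_of_isAffineOpen_preimage`, Stacks 06AD).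
[cite: StacksProject, Tag 04EX] [cite: StacksProject, Tag 06AD] -/
theorem exists_preimage_eq (hnil : IsNilpotent i.ker) (U₀ : X₀.Opens) :
    ∃ U : X.Opens, i ⁻¹ᵁ U = U₀ ∧ (IsAffineOpen U₀ → IsAffineOpen U) := by
  let e : ↥X₀ ≃ₜ ↥X := i.isClosedEmbedding.isEmbedding.toHomeomorphOfSurjective (surjective_of_isNilpotent_ker i hnil)
  have he : ⇑e = ⇑i := rfl
  let U : X.Opens := ⟨e '' (U₀ : Set X₀), e.isOpenMap _ U₀.2⟩
  have hU : i ⁻¹ᵁ U = U₀ := by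
    ext x
    change i x ∈ e '' (U₀ : Set X₀) ↔ x ∈ (U₀ : Set X₀)
    rw [← he, e.injective.mem_set_image]
  refine ⟨U, hU, fun h₀ => isAffineOpen_of_isAffineOpen_preimage i hnil ?_⟩
  rw [hU]
  exact h₀

/-- **A principal affine cover of `X₀` is the preimage of a principal affine cover of the nilpotent thickening `X`**:
given affine opens `U₀ j` of `X₀` with `U₀ j ∩ U₀ l = D(b_{jl})`, there are affine opens `U j` of `X` and `b'_{jl} ∈ Γ(X, U j)`
with `i⁻¹U j = U₀ j` and `U j ∩ U l = D(b'_{jl})` (lift `b_{jl}` along `Γ(X, U j) ↠ Γ(X₀, U₀ j)`; compare preimages).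
[cite: Hartshorne2010, Thm. 10.2 (proof), p. 81] [cite: StacksProject, Tag 06AD] -/
theorem exists_principal_affine_cover_lift (hnil : IsNilpotent i.ker) {ι : Type*} (U₀ : ι → X₀.affineOpens)
    (b : (j l : ι) → Γ(X₀, (U₀ j).1)) (hb : ∀ j l, (U₀ j).1 ⊓ (U₀ l).1 = X₀.basicOpen (b j l)) :
    ∃ (U : ι → X.affineOpens) (b' : (j l : ι) → Γ(X, (U j).1)),
      (∀ j, i ⁻¹ᵁ (U j).1 = (U₀ j).1) ∧ (∀ j l, (U j).1 ⊓ (U l).1 = X.basicOpen (b' j l)) := by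
  choose U hU hUaff using fun j => exists_preimage_eq i hnil (U₀ j).1
  -- lift the `b_{jl}` (transported to `Γ(X₀, i⁻¹U j)`) along the surjections `Γ(X, U j) ↠ Γ(X₀, i⁻¹U j)`
  have hsurj : ∀ j, Function.Surjective (i.app (U j)) := fun j => i.app_surjective (U j) (hUaff j (U₀ j).2)
  choose b' hb' using fun j l => hsurj j (X₀.presheaf.map (eqToHom (hU j)).op (b j l))
  refine ⟨fun j => ⟨U j, hUaff j (U₀ j).2⟩, b', hU, fun j l => preimage_injective_of_isNilpotent_ker i hnil ?_⟩
  change i ⁻¹ᵁ (U j ⊓ U l) = i ⁻¹ᵁ X.basicOpen (b' j l)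
  rw [Scheme.preimage_basicOpen, hb' j l, Scheme.basicOpen_res, Scheme.Hom.preimage_inf, hU j, hU l, ← hb j l]
  exact (inf_eq_right.mpr inf_le_left).symm

end Literature.AlgebraicGeometry.Morphisms

end
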